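import Summits.AtomisticToContinuum.HydrodynamicLimit.Theorems.StiffCollisionalRelaxationAprioriBoundsPartOneFixedHomogeneous
import Literature.Barriers.AtomisticToContinuum.HighMomentumCutoff
import HarnessLib

/-!
# The open stub `velocityTails` at homogeneous data: the expected Gaussian velocity moment, every flow

Supporting file of the line `Sketch` for the crux `AprioriBounds` (stmt-AtomisticToContinuum-14827), stub
`velocityTails_homogeneous` (the EQUILIBRIUM INSTANCE of the registered OPEN stub `stub_velocityTails`,
reshape r7).  The stub asks, under the crux prefix (profiles → `∃ σ₀ ∃ η₁ ∀ σ < σ₀` → classical hs-Euler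
solution on `[0, T)` → flow family with the `t = 0` LLN → `0 < t < T` with the chamber `2ρσ³ < η₁` on
`[0, t]`), for an EXPECTED Gaussian velocity moment along the flow, uniformly in large `N` and in `s ≤ t`:
`∃ c > 0, C < ⊤, N₀` with `∫⁻ expVelocityMoment c (Φ_N(s) z) dλ^N ≤ C` for all `N ≥ N₀`, `s ∈ [0, t]`
(the observable `expVelocityMoment c z = ofReal ((N+1)⁻¹ ∑ᵢ e^{c|vᵢ|²})` is the barrier file's,
`Literature/Barriers/AtomisticToContinuum/HighMomentumCutoff.lean`).  This file PROVES it at the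
homogeneous profiles `(a₀, u₀, θ₀) = (1, 0, θ₀)`, `θ₀ > 0` constant, for EVERY family of hard-sphere flows.

Proof: the landed fixed-time L¹ law of large numbers at homogeneous data (`partOneFixed_homogeneous`)
gives `λ > 0`, `C₁`, a profile `g` with `|g| ≤ C₁` on `[0, t]` and a rate `δ_N → 0` with
`E_{P_N}|(N+1)⁻¹∑ᵢ e^{λ|vᵢ(s)|²} − g(s)| ≤ δ_N`.  Since `∫ e^{λ|v|²} dμ_w = (N+1)⁻¹∑ᵢ e^{λ|vᵢ|²}`
(`integral_empiricalMeasure`), pointwise `expVelocityMoment λ w ≤ ofReal |avg − g s| + ofReal C₁`, and the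
laws being probability measures for `σ ≤ 1/2` (`isProbabilityMeasure_localGibbsLaw`),
`E expVelocityMoment λ ≤ ofReal δ_N + ofReal C₁ ≤ ofReal 1 + ofReal C₁` once `δ_N ≤ 1` (`N ≥ N₀`).
Witnesses: `c := λ`, `C := ofReal 1 + ofReal C₁`, `σ₀ := min σ₀' (1/2)`, `η₁` the one given.

No new definitions, no named facts; axioms `propext`, `Classical.choice`, `Quot.sound`.
-/

noncomputable section

open MeasureTheory Filter Set Topology
open scoped ENNReal

namespace Summit.AtomisticToContinuum.HydrodynamicLimit.Theorems.AdiabatCeiling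

open Literature.MathematicalPhysics.KineticTheory Literature.Analysis.FluidPDE

/-- **`stub_velocityTails` AT HOMOGENEOUS DATA, for every flow.**  At the profiles `(1, 0, θ₀)`, `θ₀ > 0`:
there are `σ₀ > 0` and `η₁ > 0` such that for all `0 < σ < σ₀`, every family of hard-sphere flows and every
`0 < t < T` (the rest of the crux prefix being idle), there are `c > 0`, `C < ⊤` and `N₀` with
`∫⁻ expVelocityMoment c (Φ_N(s) z) dλ^N ≤ C` for all `N ≥ N₀` and all `s ∈ [0, t]`. -/
theorem velocityTails_homogeneous :
    ∀ θ₀ : ℝ, 0 < θ₀ →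
      ∃ σ₀ : ℝ, 0 < σ₀ ∧ ∃ η₁ : ℝ, 0 < η₁ ∧ ∀ σ : ℝ, 0 < σ → σ < σ₀ →
        ∀ (T : ℝ) (ρ θ : ℝ → T3 → ℝ) (u : ℝ → T3 → V3), IsHardSphereEulerSolution σ T ρ u θ →
        ∀ Φ : (N : ℕ) → HardSphereFlow (Torus.geometry (Fin 3)) (hsDiameter σ N) (N + 1),
          TendstoHydroFieldsAt
              (fun N => localGibbsLaw σ (fun _ => 1) (fun _ => 0) (fun _ => θ₀) N (Φ N)) Φ ρ u θ 0 →
          ∀ t : ℝ, 0 < t → t < T → (∀ s ∈ Icc 0 t, ∀ x, 2 * ρ s x * σ ^ 3 < η₁) →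
            ∃ c : ℝ, 0 < c ∧ ∃ C : ℝ≥0∞, C < ⊤ ∧ ∃ N₀ : ℕ, ∀ N : ℕ, N₀ ≤ N → ∀ s ∈ Icc 0 t,
              ∫⁻ z, Literature.Barriers.AtomisticToContinuum.expVelocityMoment c ((Φ N).flow s z)
                ∂(localGibbsLaw σ (fun _ => 1) (fun _ => 0) (fun _ => θ₀) N (Φ N)) ≤ C := by
  intro θ₀ hθ
  obtain ⟨σ₀, hσ₀, η₁, hη₁, H⟩ := partOneFixed_homogeneous θ₀ hθ
  refine ⟨min σ₀ (1 / 2), lt_min hσ₀ one_half_pos, η₁, hη₁,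
    fun σ hσ hσlt T ρ θ u hsol Φ hlim t ht htT hcham => ?_⟩
  have hσ₁ : σ < σ₀ := hσlt.trans_le (min_le_left _ _)
  have hσ2 : σ ≤ 1 / 2 := (hσlt.trans_le (min_le_right _ _)).le
  obtain ⟨lam, C₁, hlam, g, _hgm, hgC, δ, hδ, hbound⟩ :=
    H σ hσ hσ₁ T ρ θ u hsol Φ hlim t ht htT hcham
  -- the rate is eventually `≤ 1`
  obtain ⟨N₀, hN₀⟩ := eventually_atTop.1 (hδ.eventually (eventually_le_nhds one_pos))
  refine ⟨lam, hlam, ENNReal.ofReal 1 + ENNReal.ofReal C₁,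
    ENNReal.add_lt_top.2 ⟨ENNReal.ofReal_lt_top, ENNReal.ofReal_lt_top⟩, N₀, fun N hN s hs => ?_⟩
  set P : Measure (Config (N + 1) (Fin 3) T3) :=
    localGibbsLaw σ (fun _ => 1) (fun _ => 0) (fun _ => θ₀) N (Φ N) with hP
  haveI : IsProbabilityMeasure P :=
    isProbabilityMeasure_localGibbsLaw (u₀ := fun _ => (0 : V3)) continuous_const continuous_const
      continuous_const (fun _ => one_pos) (fun _ => hθ) hσ2 N (Φ N)
  -- the empirical average as an integral against the empirical measure
  have hGemp : ∀ w : Config (N + 1) (Fin 3) T3,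
      Literature.Barriers.AtomisticToContinuum.expVelocityMoment lam w =
        ENNReal.ofReal (∫ y, Real.exp (lam * ‖y.2‖ ^ 2) ∂(empiricalMeasure w)) := fun w => by
    rw [Literature.Barriers.AtomisticToContinuum.expVelocityMoment_eq, integral_empiricalMeasure]
  have hC₁ : ∀ a : ℝ, ENNReal.ofReal a ≤ ENNReal.ofReal |a - g s| + ENNReal.ofReal C₁ := fun a =>
    calc ENNReal.ofReal a ≤ ENNReal.ofReal (|a - g s| + C₁) :=
          ENNReal.ofReal_le_ofReal (by
            linarith [le_abs_self a, abs_sub_abs_le_abs_sub a (g s), hgC s hs])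
      _ ≤ ENNReal.ofReal |a - g s| + ENNReal.ofReal C₁ := ENNReal.ofReal_add_le
  calc ∫⁻ z, Literature.Barriers.AtomisticToContinuum.expVelocityMoment lam ((Φ N).flow s z) ∂P
      ≤ ∫⁻ z, (ENNReal.ofReal
            |(∫ y, Real.exp (lam * ‖y.2‖ ^ 2) ∂(empiricalMeasure ((Φ N).flow s z))) - g s| +
          ENNReal.ofReal C₁) ∂P := by
        refine lintegral_mono fun z => ?_
        rw [hGemp]
        exact hC₁ _
    _ = ∫⁻ z, ENNReal.ofReal
            |(∫ y, Real.exp (lam * ‖y.2‖ ^ 2) ∂(empiricalMeasure ((Φ N).flow s z))) - g s| ∂P +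
          ENNReal.ofReal C₁ := by
        rw [lintegral_add_right _ measurable_const, lintegral_const, measure_univ, mul_one]
    _ ≤ ENNReal.ofReal (δ N) + ENNReal.ofReal C₁ := add_le_add (hbound N s hs) le_rfl
    _ ≤ ENNReal.ofReal 1 + ENNReal.ofReal C₁ :=
        add_le_add (ENNReal.ofReal_le_ofReal (hN₀ N hN)) le_rfl

end Summit.AtomisticToContinuum.HydrodynamicLimit.Theorems.AdiabatCeiling
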